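import Summits.QuantumFields.YangMills.Theorems.UnitScaleTiltProp7FlatSliceRegularity
import HarnessLib

/-!
# Route `UnitScaleTilt`, crux K1 child «MinimiserStabilityRegPr» (stmt-QuantumFields-19200), registered stub `stub_prop7From14` (V3, skeleton v7
# cc37a1787726) — lane B: **THE LETTER FORMS OF THE FLAT SLICE REGULARITY FOR EVERY NESTED FAMILY `D : Domains P`** (cube sequences, several levels —
# the geometry of [Balaban1985Variational] Sect. F (144) / [Balaban1984PropagatorsII] (2.87)–(2.90) and of RULING g20-№13's cube-sequence pillar F3′)

Cell `ym3-torus` ∕ fleet seat `ym-ust-19200-p3` (WIDTH-LEVER lane B of V3; HUMAN RULING D-0037, YM ladder rung R3).  `--supports stmt-QuantumFields-19200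
--as helper`.  The one-level (`twoScale j hj1 ∅`, whole torus) letter forms are `Prop7FlatSliceRegularity.abs_le_of_slice_of_letters` / `…T3`; the ALGEBRA
behind them (§1 of that file: `sub_GE_eq_H_of_slice`, `exists_QsE_eq_of_orth_ker`) holds for every `Domains D`.  THIS FILE states the sup bound for every
`D` with the letters of `G = Δ_a⁻¹`, of the minimal extension `H` and of the constraint map `Q` as HYPOTHESES — to be discharged, for domain sequences, by the
cube-sequence bridge (ym3-torus-p1 g15's F3′ `FlatCubeSequence*`, lit-balaban [B6] Prop 2.2 / Cor 2.8 letters) exactly as p1 g14's one-level letters discharge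
the one-level forms.
* `abs_le_of_slice_of_letters_D` — `R∂*A = 0`, `sup|∂*∂A − Q*ω| ≤ B`, `sup_𝔅|QA| ≤ β` ⇒ `|A(e)| ≤ C_G·B + C_H·(β + C_G·B)`.
* `abs_le_of_critical_of_letters_D` — the (127) form: `⟨δ, ∂*∂A + r⟩ = 0 (Qδ = 0)`, `sup|r| ≤ B`.
No definition, no sorry, standard axioms.  NOT a claim about the mass gap.

References: T. Bałaban, CMP **102** (1985) 277–309 [Balaban1985Variational] ((127) p.297, (133)–(136) p.298, (144) p.300, (157)/(165) pp.302–303); CMP **96**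
(1984) 223–250 [Balaban1984PropagatorsII] ((2.87)–(2.90) p.239).
-/

set_option autoImplicit false

noncomputable section

open scoped BigOperators InnerProductSpace

namespace Summit.QuantumFields.YangMills.Theorems.Prop7FlatSliceRegularity

open Literature.MathematicalPhysics.QuantumFieldTheory.Balaban1983to89
open Literature.MathematicalPhysics.QuantumFieldTheory.BalabanImbrieJaffe1984to88.BIJ85AxialPropagator411 (BondSpace PlaqSpace)
open LatticeFieldCalculus B6SectADomainsV1 B6SectAOperatorsV1 B6SectAVectorModelV1

variable {P : Params}

/-! ## The letter forms for every `Domains D` -/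

section LettersD

variable (D : Domains P)

/-- **SUP REGULARITY MODULO MULTIPLIERS, LETTER FORM, EVERY `Domains D`**: for any map `H` with `Q∘H = id`, `Δ_a`-orthogonality and a sup letter
`sup|Hβ| ≤ C_H·sup|β|`, any `G`-sup letter `sup|Gu| ≤ C_G·sup|u|`, a real bond field `A` with `R∂*A = 0`, EVERY `ω` with `sup|∂*∂A − Q*ω| ≤ B` and
`sup|QA| ≤ β` (sup over the constraint index set `𝔅` of `D`): `|A(e)| ≤ C_G·B + C_H·(β + C_G·B)`.  (The one-level instance is §2's
`abs_le_of_slice_of_letters`; for domain sequences the letters are the cube-sequence bridge's.) [cite: Balaban1985Variational, (157) p.302, (165) p.303; Balaban1984PropagatorsII, (2.87)-(2.90) p.239] -/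
theorem abs_le_of_slice_of_letters_D {c : ℝ} (hc : c ≠ 0) {w : BondIdx D → ℝ} (hw : ∀ i, 0 < w i)
    {H : BondIdxSpace D → BondSpace P} (hHQ : ∀ β, QE D (H β) = β)
    (hHorth : ∀ β δ, QE D δ = 0 → ⟪δ, deltaAE D c w (H β)⟫_ℝ = 0)
    {CG CH : ℝ}
    (hGsup : ∀ (u : BondSpace P) (B : ℝ), (∀ e, |u e| ≤ B) → ∀ e, |GE D hc hw u e| ≤ CG * B)
    (hHsup : ∀ (β' : BondIdxSpace D) (b : ℝ), (∀ i, |β' i| ≤ b) → ∀ e, |H β' e| ≤ CH * b)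
    (x : BondSpace P) (hx : RE D c (dsE c x) = 0) (ω : BondIdxSpace D) {B β : ℝ}
    (hB : ∀ e, |(dcsE c (dcE c x) - QsE D ω) e| ≤ B)
    (hβ : ∀ i, |QE D x i| ≤ β)
    (hQsup : ∀ (u : BondSpace P) (b : ℝ), (∀ e, |u e| ≤ b) → ∀ i, |QE D u i| ≤ b) (e : PBond P 0) :
    |x e| ≤ CG * B + CH * (β + CG * B) := by
  have hrep := sub_GE_eq_H_of_slice D hc hw hHQ hHorth hx ω
  set u := dcsE c (dcE c x) - QsE D ω with hu
  have hGu : ∀ e, |GE D hc hw u e| ≤ CG * B := hGsup u B hB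
  have hdat : ∀ i, |(QE D x - QE D (GE D hc hw u)) i| ≤ β + CG * B := fun i => by
    rw [PiLp.sub_apply]
    exact (abs_sub _ _).trans (add_le_add (hβ i) (hQsup _ _ hGu i))
  have hxe : x e = GE D hc hw u e + H (QE D x - QE D (GE D hc hw u)) e := by
    have h := congrArg (fun v : BondSpace P => v e) hrep
    simp only [PiLp.sub_apply] at h
    linarith
  rw [hxe]
  exact (abs_add_le _ _).trans (add_le_add (hGu e) (hHsup _ _ hdat e))

/-- **THE CRITICAL-POINT LETTER FORM, EVERY `Domains D`**: (127) `⟨δ, ∂*∂A + r⟩ = 0 (Qδ = 0)` with `sup|r| ≤ B`, `sup|QA| ≤ β` ⇒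
`|A(e)| ≤ C_G·B + C_H·(β + C_G·B)`. [cite: Balaban1985Variational, (127) p.297, (133)-(136) p.298] -/
theorem abs_le_of_critical_of_letters_D {c : ℝ} (hc : c ≠ 0) {w : BondIdx D → ℝ} (hw : ∀ i, 0 < w i)
    {H : BondIdxSpace D → BondSpace P} (hHQ : ∀ β, QE D (H β) = β)
    (hHorth : ∀ β δ, QE D δ = 0 → ⟪δ, deltaAE D c w (H β)⟫_ℝ = 0)
    {CG CH : ℝ}
    (hGsup : ∀ (u : BondSpace P) (B : ℝ), (∀ e, |u e| ≤ B) → ∀ e, |GE D hc hw u e| ≤ CG * B)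
    (hHsup : ∀ (β' : BondIdxSpace D) (b : ℝ), (∀ i, |β' i| ≤ b) → ∀ e, |H β' e| ≤ CH * b)
    (x r : BondSpace P) (hx : RE D c (dsE c x) = 0)
    (hcrit : ∀ δ, QE D δ = 0 → ⟪δ, dcsE c (dcE c x) + r⟫_ℝ = 0) {B β : ℝ}
    (hB : ∀ e, |r e| ≤ B) (hβ : ∀ i, |QE D x i| ≤ β)
    (hQsup : ∀ (u : BondSpace P) (b : ℝ), (∀ e, |u e| ≤ b) → ∀ i, |QE D u i| ≤ b) (e : PBond P 0) :
    |x e| ≤ CG * B + CH * (β + CG * B) := by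
  obtain ⟨ω, hω⟩ := exists_QsE_eq_of_orth_ker D hcrit
  have hr : dcsE c (dcE c x) - QsE D ω = -r := by rw [hω]; abel
  refine abs_le_of_slice_of_letters_D D hc hw hHQ hHorth hGsup hHsup x hx ω (B := B) (fun e' => ?_) hβ hQsup e
  rw [hr, PiLp.neg_apply, abs_neg]
  exact hB e'

end LettersD

end Summit.QuantumFields.YangMills.Theorems.Prop7FlatSliceRegularity

end
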